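import Summits.HodgeConjecture.HodgeConjecture.Theorems.MarkmanPartnerTransportPartnerTransportCycleDescent
import Summits.HodgeConjecture.HodgeConjecture.Theorems.MarkmanPartnerTransportLowPicardRMPartneredCells
import Summits.HodgeConjecture.HodgeConjecture.Theorems.MarkmanPartnerTransportLowPicardRMCellsKappa
import Summits.HodgeConjecture.HodgeConjecture.Theorems.MarkmanPartnerTransportPicardThreeK3SquaresQuotientDescent

/-!
# Route MarkmanPartnerTransport · crux #5 `LowPicardRealMultiplication` (stmt-HodgeConjecture-19653) —
# «PARTNERED LOSSLESS IFF»: for a partnered member of a cell, HC⁴(X) ⟺ HC⁴(S × S) ⟺ ONE cycle on the K3 partner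

Cell hodge-nonav, chapter ROUTE-P1AL; planner p1 g40 GO (E) (2026-08-28T18:43Z), file 2∕2 (leaf: imports the route file
through `…LowPicardRMPartneredCells`); prover seat hodge-nonav-20241-p1 (gen 16). `--supports stmt-HodgeConjecture-19653` helper.

The partner reduction of «PARTNERED CELLS» (`hodgeConjectureFor_of_partner_of_rmGenerator_of_cycleInduced_natDegree`: ONE
cycle-induced endomorphism of eigenvalue degree `d` on the K3 partner `S` ⟹ HC⁴(X)) is EXACT:

* `exists_oneCycleK3_of_partner_of_hodgeConjectureFor` — **HC⁴(X) ⟹ `OneCycleK3[S, hS, d]`** for a marked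
  `K3^{[2]}`-type `X` with `RMgen[X, φ, z, d]` and a K3 partner `(S, η, p, x, g)` ((g1), (g2), (g5)): compress the RM
  generator to `t_X = π_T θ_X π_T` (admissible, `q`-self-adjoint, same eigenvalue; `exists_transcendentalProjector`);
  HC⁴(X) makes `κ_{t_X}` algebraic (`OrphanSR.kappaClass_mem_algebraicClasses_of_hodgeConjectureFor`, fact-free), T3C
  (`exists_corrAction_eq_of_kappaClass`; Verbitsky–Guan + Charles–Markman) makes `t_X` cycle-induced, and «CYCLE DESCENT»
  (`exists_cycleInduced_descent_of_partner_of_facts`, file 1) carries it to a cycle-induced transcendental endomorphism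
  of `S` with the same eigenvalue, of degree `d`;
* **`hodgeConjectureFor_partnerSquare_of_hodgeConjectureFor`** — HC⁴(X) ⟹ HC⁴(S ⊗ S) (then «K3-CELL-GEN SOCKET» with the
  descended generator of «PARTNER-RM-TYPE»);
* **`hodgeConjectureFor_iff_partnerSquare`** — HC⁴(X) ⟺ HC⁴(S ⊗ S) (⟸ is `PartnerTransport`);
* **`hodgeConjectureFor_iff_oneCycleK3_of_partner`** — HC⁴(X) ⟺ `OneCycleK3[S, hS, d]`;
* **`cellHC_iff_oneCycleK3_of_partner (ρ d)`** — BY NAME on every cell: HC⁴ for all partnered members of the cell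
  `(ρ, d)` ⟺ one cycle of eigenvalue degree `d` on every partner (the partner datum (g1), (g2), (g5) EXPLICIT on both
  sides; nothing smuggled).

WHY NO SELF-ADJOINTNESS ∕ ¬CM HYPOTHESIS: only the `q`-self-adjoint RM generator `θ_X` of the `RMgen` datum is
transported (so T3C applies to it), and on `S` everything else is a rational POLYNOMIAL in the descended generator
(«PARTNER-RM-TYPE» + «K3-CELL-GEN»); for a general K3 square the anti-self-adjoint part of a CM endomorphism field would
have no class in `H⁴(X) = Sym² H²(X)` at all — consistent, and irrelevant inside the RM cells.

CONDITIONAL on {`Beauville1983_hilbertSquare_markedIncidence`, `Beauville1983_hilbertSquare_blowupDiagonal_surjection`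
(⟸ only), `OGrady2008_dualBBFClass_algebraic`, `Markman2024_rationalHodgeIsometry_lift_algebraic_marked` (⟸ only),
`Markman2024_rationalHodgeIsometry_algebraic_marked`, `Voisin2003_cupProduct_algebraicClasses`,
`Huybrechts_K3_marking_exists`, `VerbitskyGuan_cohomology_K3HilbertSquareType`,
`CharlesMarkman2013_lefschetzStandard_K3HilbertType`}; no definition, no sorry, no new named fact. Credits nothing:
neither side of any iff is proved here; the crux and HC stay open.

References: E. Markman, Compos. Math. 160 (2024) Thm. 1.1, 1.4; F. Charles, E. Markman, Compos. Math. 149 (2013)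
Thm. 1.1; A. Beauville, J. Differential Geom. 18 (1983) §6; K. O'Grady, Commun. Contemp. Math. 10 (2008) §3; B. van
Geemen, M. Schütt, Forum Math. Sigma 13 (2025) e2, §4.8, Rem. 4.9; Yu. G. Zarhin, J. reine angew. Math. 341 (1983) Thm. 1.5.1.
-/

noncomputable section

set_option linter.dupNamespace false

open scoped Matrix
open Module CategoryTheory MonoidalCategory Polynomial
open Literature.AlgebraicTopology.SingularHomology Literature.Geometry.Kaehler
open Literature.AlgebraicGeometry Literature.AlgebraicGeometry.Motives Literature.AlgebraicGeometry.HodgeTheory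
open Literature.AlgebraicGeometry.Hyperkaehler Literature.AlgebraicGeometry.Surfaces
open Literature.AlgebraicGeometry.HilbertScheme
open Summit.HodgeConjecture.HodgeConjecture.Theorems.NikulinTwinTransport
open Summit.HodgeConjecture.HodgeConjecture.Theorems.MarkmanPartnerTransport.BBFPositivity

namespace Summit.HodgeConjecture.HodgeConjecture.Theorems.MarkmanPartnerTransport.PartnerLattice

/-- `MarkedK3Sq[X, φ, P, z]`: VERBATIM the `let MarkedK3Sq := …` binder of the route declarations of
MarkmanPartnerTransport (clauses (m1)–(m6)). Local notation only. -/
local notation3 (prettyPrint := false) "MarkedK3Sq[" X ", " φ ", " P ", " z "]" =>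
  (((IsIntegralClass P ∧ ∀ Q : complexBetti X (2 * 4), IsIntegralClass Q → ∃ n : ℤ, Q = n • P) ∧
    (∀ c : complexBetti X 2, IsIntegralClass c ↔ ∃ v : K3HilbertIndex → ℤ, φ c = fun i => (v i : ℂ)) ∧
    (∀ a : complexBetti X 2, cupPowTwo a 4 = ((3 : ℂ) * (k3HilbertForm 2 (φ a) (φ a)) ^ 2) • P) ∧
    (IsOfHodgeType 4 X 2 2 0 (LinearEquiv.symm φ z) ∧
      ∀ τ : complexBetti X 2, IsOfHodgeType 4 X 2 2 0 τ → ∃ t : ℂ, τ = t • LinearEquiv.symm φ z) ∧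
    (∀ c : complexBetti X 2, IsOfHodgeType 4 X 2 1 1 c ↔
      (k3HilbertForm 2 (φ c) z = 0 ∧ k3HilbertForm 2 (φ c) (star z) = 0)) ∧
    (k3HilbertForm 2 z z = 0 ∧ 0 < (k3HilbertForm 2 (star z) z).re)))

/-- `MarkedK3[S, η, p, x]`: VERBATIM the `let MarkedK3 := …` binder of the route declarations (`p ≠ 0`, the six
marking clauses, the projective period point). Local notation only. -/
local notation3 (prettyPrint := false) "MarkedK3[" S ", " η ", " p ", " x "]" =>
  (p ≠ 0 ∧ (IsIntegralClass p ∧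
    (∀ q : complexBetti S (2 * 2), IsIntegralClass q → ∃ n : ℤ, q = n • p) ∧
    (∀ c : complexBetti S (2 * 1), IsIntegralClass c ↔ ∃ v : K3Index → ℤ, η c = fun i => (v i : ℂ)) ∧
    (∀ a b : complexBetti S (2 * 1),
      cupProduct (rfl : 2 * 1 + 2 * 1 = 2 * 2) a b = k3Form (η a) (η b) • p) ∧
    IsOfHodgeType 2 S (2 * 1) 2 0 (LinearEquiv.symm η x) ∧
    (∀ τ : complexBetti S (2 * 1), IsOfHodgeType 2 S (2 * 1) 2 0 τ →
      ∃ t : ℂ, τ = t • LinearEquiv.symm η x)) ∧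
    (k3Form x x = 0 ∧ 0 < (k3Form (star x) x).re ∧
      ∃ u : K3Index → ℤ, k3Form (fun i => (u i : ℂ)) x = 0 ∧ 0 < ∑ i, ∑ j, u i * k3Gram i j * u j))

/-- `SpIso[X, φ]`: VERBATIM the `let SpannedByIsometries := …` binder of the route declarations (with
`IsBBFTransc` unfolded). Local notation only. -/
local notation3 (prettyPrint := false) "SpIso[" X ", " φ "]" =>
  (∀ f : complexBetti X 2 →ₗ[ℂ] complexBetti X 2, (∀ y, IsRationalClass y → IsRationalClass (f y)) →
    (∀ (i j : ℕ) y, IsOfHodgeType 4 X 2 i j y → IsOfHodgeType 4 X 2 i j (f y)) →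
    (∀ d : complexBetti X 2, d ∈ algebraicClasses X 1 → f d = 0) →
    (∀ y : complexBetti X 2, ∀ d : complexBetti X 2, d ∈ algebraicClasses X 1 →
      k3HilbertForm 2 (φ (f y)) (φ d) = 0) →
    ∃ (k : ℕ) (c : Fin k → ℚ) (g : Fin k → (complexBetti X 2 →ₗ[ℂ] complexBetti X 2)),
      (∀ i, Function.Bijective (g i) ∧ (∀ y, IsRationalClass y → IsRationalClass (g i y)) ∧
        (∀ (a b : ℕ) y, IsOfHodgeType 4 X 2 a b y → IsOfHodgeType 4 X 2 a b (g i y)) ∧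
        (∀ a b, k3HilbertForm 2 (φ (g i a)) (φ (g i b)) = k3HilbertForm 2 (φ a) (φ b))) ∧
      ∀ y : complexBetti X 2, (∀ d : complexBetti X 2, d ∈ algebraicClasses X 1 →
        k3HilbertForm 2 (φ y) (φ d) = 0) → f y = ∑ i : Fin k, ((c i : ℂ) • g i y))

/-- `RMgen[X, φ, z, d]` (VERBATIM `…LowPicardRMCells`). Local notation only. -/
local notation3 (prettyPrint := false) "RMgen[" X ", " φ ", " z ", " d "]" =>
  (∃ θ : complexBetti X 2 →ₗ[ℂ] complexBetti X 2, (∀ y, IsRationalClass y → IsRationalClass (θ y)) ∧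
    (∀ (i j : ℕ) y, IsOfHodgeType 4 X 2 i j y → IsOfHodgeType 4 X 2 i j (θ y)) ∧
    (∀ y w : complexBetti X 2, k3HilbertForm 2 (φ (θ y)) (φ w) = k3HilbertForm 2 (φ y) (φ (θ w))) ∧
    ∃ ev : ℂ, θ (LinearEquiv.symm φ z) = ev • LinearEquiv.symm φ z ∧ ev.im = 0 ∧
      (minpoly ℚ ev).natDegree = d ∧
      (∃ n : ℕ, 3 ≤ n ∧ d * n + Module.finrank ℂ ↥(algebraicClasses X 1) = 23) ∧
      ∀ f : complexBetti X 2 →ₗ[ℂ] complexBetti X 2, (∀ y, IsRationalClass y → IsRationalClass (f y)) →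
        (∀ (i j : ℕ) y, IsOfHodgeType 4 X 2 i j y → IsOfHodgeType 4 X 2 i j (f y)) →
        ∃ c : Fin d → ℚ, ∀ y : complexBetti X 2,
          (∀ a : complexBetti X 2, a ∈ algebraicClasses X 1 → k3HilbertForm 2 (φ y) (φ a) = 0) →
            f y = ∑ i : Fin d, ((c i : ℂ) • (θ ^ (i : ℕ)) y))

/-- `Partner[X, φ, S, η, g]`: clauses (g1), (g2), (g5) of the route's `IsK3Partner` datum — `g : H²(S) → H²(X)`
rational, type-preserving, isometric on cup-transcendental classes (the clauses `partnerTransport_explicit` uses).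
Local notation only. -/
local notation3 (prettyPrint := false) "Partner[" X ", " φ ", " S ", " η ", " g "]" =>
  ((∀ a, IsRationalClass a → IsRationalClass (g a)) ∧
    (∀ (i j : ℕ) a, IsOfHodgeType 2 S (2 * 1) i j a → IsOfHodgeType 4 X 2 i j (g a)) ∧
    (∀ a b, (∀ d ∈ algebraicClasses S 1, cupProduct (rfl : 2 * 1 + 2 * 1 = 2 * 2) a d = 0) →
      (∀ d ∈ algebraicClasses S 1, cupProduct (rfl : 2 * 1 + 2 * 1 = 2 * 2) b d = 0) →
      k3HilbertForm 2 (φ (g a)) (φ (g b)) = k3Form (η a) (η b)))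

/-- `OneCycleK3[S, hS, d]`: ONE cycle-induced transcendental endomorphism of the K3 surface `S` (rational,
type-preserving, kills `N¹`, image `⊥ N¹`, induced by an algebraic class on `S × S`) whose `(2,0)`-eigenvalue has
minimal polynomial of degree `d`. Local notation only. -/
local notation3 (prettyPrint := false) "OneCycleK3[" S ", " hS ", " d "]" =>
  (∃ t : complexBetti S (2 * 1) →ₗ[ℂ] complexBetti S (2 * 1),
    IsCycleInducedTranscendentalEndomorphism S (IsK3Surface.isSmoothProjective hS) t ∧
    ∃ (σ₁ : complexBetti S (2 * 1)) (ev : ℂ), IsOfHodgeType 2 S (2 * 1) 2 0 σ₁ ∧ σ₁ ≠ 0 ∧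
      t σ₁ = ev • σ₁ ∧ (minpoly ℚ ev).natDegree = d)

/-- `OneIrrCycleK3[S, hS]`: ONE cycle-induced transcendental endomorphism of `S` with an IRRATIONAL
`(2,0)`-eigenvalue. Local notation only. -/
local notation3 (prettyPrint := false) "OneIrrCycleK3[" S ", " hS "]" =>
  (∃ t : complexBetti S (2 * 1) →ₗ[ℂ] complexBetti S (2 * 1),
    IsCycleInducedTranscendentalEndomorphism S (IsK3Surface.isSmoothProjective hS) t ∧
    ∃ (σ₁ : complexBetti S (2 * 1)) (ev : ℂ), IsOfHodgeType 2 S (2 * 1) 2 0 σ₁ ∧ σ₁ ≠ 0 ∧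
      t σ₁ = ev • σ₁ ∧ ∀ a : ℚ, (a : ℂ) ≠ ev)

/-- `Kap[φ, g] = Σ_{ij} (G⁻¹)_{ij} · φ⁻¹eᵢ ∪ g(φ⁻¹eⱼ) ∈ H⁴(X(ℂ); ℂ)`, the kappa class of an endomorphism `g`
of `H²(X(ℂ); ℂ)` (VERBATIM `…K3Sq2TypeHodgeGraphClassesGeneral`). Local notation only. -/
local notation3 (prettyPrint := false) "Kap[" φ ", " g "]" =>
  (∑ i : K3HilbertIndex, ∑ j : K3HilbertIndex,
    (((k3HilbertGram 2).map (Int.cast : ℤ → ℂ))⁻¹ i j) •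
      cupProduct (rfl : 2 + 2 = 2 * 2) ((LinearEquiv.symm φ) (Pi.single i 1))
        (g ((LinearEquiv.symm φ) (Pi.single j 1))))

/-- `PartneredHC[ρ, d]`: **HC⁴ for every PARTNERED member of the cell `(ρ, d)`** — every member `(X, φ, P, z)`
(`MarkedK3Sq`, `¬ SpannedByIsometries`, `ρ(X) = ρ`, `RMgen[X, φ, z, d]`) carrying a K3 partner `(S, η, p, x, g)`
((g1), (g2), (g5)) satisfies `HodgeConjectureFor 4 X`. Local notation only. -/
local notation3 (prettyPrint := false) "PartneredHC[" ρ ", " d "]" =>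
  (∀ (X : SchemeOver ℂ), IsSmoothProjective 4 X → IsOfK3HilbertSquareType X →
    ∀ (φ : complexBetti X 2 ≃ₗ[ℂ] (K3HilbertIndex → ℂ)) (P : complexBetti X (2 * 4)) (z : K3HilbertIndex → ℂ),
      MarkedK3Sq[X, φ, P, z] → ¬ SpIso[X, φ] → Module.finrank ℂ ↥(algebraicClasses X 1) = ρ →
        RMgen[X, φ, z, d] →
        ∀ (S : SchemeOver ℂ) (_ : IsK3Surface S) (η : complexBetti S (2 * 1) ≃ₗ[ℂ] (K3Index → ℂ))
          (p : complexBetti S (2 * 2)) (x : K3Index → ℂ) (g : complexBetti S (2 * 1) →ₗ[ℂ] complexBetti X 2),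
          MarkedK3[S, η, p, x] → Partner[X, φ, S, η, g] → HodgeConjectureFor 4 X)

/-- `PartneredOneCycleK3[ρ, d]`: **every K3 partner of a member of the cell `(ρ, d)` carries ONE cycle-induced
transcendental endomorphism of `(2,0)`-eigenvalue degree `d`**. Local notation only. -/
local notation3 (prettyPrint := false) "PartneredOneCycleK3[" ρ ", " d "]" =>
  (∀ (X : SchemeOver ℂ), IsSmoothProjective 4 X → IsOfK3HilbertSquareType X →
    ∀ (φ : complexBetti X 2 ≃ₗ[ℂ] (K3HilbertIndex → ℂ)) (P : complexBetti X (2 * 4)) (z : K3HilbertIndex → ℂ),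
      MarkedK3Sq[X, φ, P, z] → ¬ SpIso[X, φ] → Module.finrank ℂ ↥(algebraicClasses X 1) = ρ →
        RMgen[X, φ, z, d] →
        ∀ (S : SchemeOver ℂ) (hS : IsK3Surface S) (η : complexBetti S (2 * 1) ≃ₗ[ℂ] (K3Index → ℂ))
          (p : complexBetti S (2 * 2)) (x : K3Index → ℂ) (g : complexBetti S (2 * 1) →ₗ[ℂ] complexBetti X 2),
          MarkedK3[S, η, p, x] → Partner[X, φ, S, η, g] → OneCycleK3[S, hS, d])

variable {X S : SchemeOver ℂ} {φ : complexBetti X 2 ≃ₗ[ℂ] (K3HilbertIndex → ℂ)} {P : complexBetti X (2 * 4)}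
  {z : K3HilbertIndex → ℂ} {η : complexBetti S (2 * 1) ≃ₗ[ℂ] (K3Index → ℂ)} {p : complexBetti S (2 * 2)}
  {x : K3Index → ℂ}

/-! ### §1 HC⁴(X) ⟹ one cycle on the partner -/

/-- **HC⁴(X) ⟹ `OneCycleK3[S, hS, d]` for a partnered RM fourfold** (module docstring: compress the RM generator to
`π_T θ_X π_T`, HC⁴ ⟹ `κ` algebraic ⟹ T3C ⟹ cycle-induced, then «CYCLE DESCENT»). Modulo {Beauville incidence, O'Grady,
Voisin cup, Markman isometry-algebraic, Verbitsky–Guan, Charles–Markman}. [cite: Markman2024, §1.1 Thm. 1.1]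
[cite: CharlesMarkman2013, Thm. 1.1 (§1)] [cite: Beauville1983, §6 Prop. 6] [cite: OGrady2008NumericalK3Square, §3] -/
theorem exists_oneCycleK3_of_partner_of_hodgeConjectureFor (hBI : Beauville1983_hilbertSquare_markedIncidence)
    (hO : OGrady2008_dualBBFClass_algebraic) (hcup : Voisin2003_cupProduct_algebraicClasses)
    (hMkI : Markman2024_rationalHodgeIsometry_algebraic_marked) (hV : VerbitskyGuan_cohomology_K3HilbertSquareType)
    (hB : CharlesMarkman2013_lefschetzStandard_K3HilbertType)
    (hX : IsSmoothProjective 4 X) (hK : IsOfK3HilbertSquareType X) (hM : MarkedK3Sq[X, φ, P, z]) {d : ℕ}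
    (hR : RMgen[X, φ, z, d]) (hS : IsK3Surface S) (hMS : MarkedK3[S, η, p, x])
    {g : complexBetti S (2 * 1) →ₗ[ℂ] complexBetti X 2} (hg : Partner[X, φ, S, η, g]) (hHC : HodgeConjectureFor 4 X) :
    OneCycleK3[S, hS, d] := by
  classical
  obtain ⟨-, -, -, -, h11, -⟩ := id hM
  obtain ⟨θX, hθrat, hθtyp, hθsa, ev, hθev, -, hdeg, -, -⟩ := hR
  obtain ⟨πT, hT1, hT2, hT3, -, hT5, hT6, hT7⟩ := exists_transcendentalProjector hX hM
  -- the compressed generator `t_X = π_T θ_X π_T`: admissible, self-adjoint, same eigenvalue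
  set tX : complexBetti X 2 →ₗ[ℂ] complexBetti X 2 := πT ∘ₗ θX ∘ₗ πT with htXdef
  have htX : ∀ y, tX y = πT (θX (πT y)) := fun y => rfl
  have ht1 : ∀ y, IsRationalClass y → IsRationalClass (tX y) := fun y hy => by
    rw [htX]; exact hT5 _ (hθrat _ (hT5 _ hy))
  have ht2 : ∀ (i j : ℕ) y, IsOfHodgeType 4 X 2 i j y → IsOfHodgeType 4 X 2 i j (tX y) := fun i j y hy => by
    rw [htX]; exact hT7 i j _ (hθtyp i j _ (hT7 i j _ hy))
  have ht3 : ∀ d : complexBetti X 2, d ∈ algebraicClasses X 1 → tX d = 0 := fun d hd => by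
    rw [htX, hT1 d hd, map_zero, map_zero]
  have ht4 : ∀ y : complexBetti X 2, ∀ d : complexBetti X 2, d ∈ algebraicClasses X 1 →
      k3HilbertForm 2 (φ (tX y)) (φ d) = 0 := fun y d hd => by
    rw [htX]; exact hT3 _ d hd
  have htsa : ∀ y w : complexBetti X 2, k3HilbertForm 2 (φ (tX y)) (φ w) = k3HilbertForm 2 (φ y) (φ (tX w)) :=
    fun y w => by rw [htX, htX, hT6, hθsa, ← hT6]
  have hσT : ∀ d : complexBetti X 2, d ∈ algebraicClasses X 1 →
      k3HilbertForm 2 (φ (LinearEquiv.symm φ z)) (φ d) = 0 := fun d hd => by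
    rw [LinearEquiv.apply_symm_apply, k3HilbertForm_comm]
    exact ((h11 d).1 (isOfHodgeType_of_mem_algebraicClasses_of_isSmoothProjective hX 1 hd)).1
  have htev : tX (LinearEquiv.symm φ z) = ev • LinearEquiv.symm φ z := by
    rw [htX, hT2 _ hσT, hθev, map_smul, hT2 _ hσT]
  -- HC⁴(X) ⟹ `κ_{t_X}` algebraic ⟹ `t_X` cycle-induced (T3C)
  have hκ : Kap[φ, tX] ∈ algebraicClasses X 2 :=
    OrphanSR.kappaClass_mem_algebraicClasses_of_hodgeConjectureFor hX hM hHC tX ht1 ht2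
  have htZ := exists_corrAction_eq_of_kappaClass hV hB hX hK hM tX htsa hκ
  -- «CYCLE DESCENT»
  obtain ⟨hp0, hmk, hxx, hxpos, hu⟩ := hMS
  obtain ⟨hg1, hg2, hg5⟩ := hg
  have h20 : IsOfHodgeType 2 S (2 * 1) 2 0 (η.symm x) := hmk.2.2.2.2.1
  have hxne : η.symm x ≠ 0 := fun h0 => ne_zero_of_star_self_re_pos hxpos (by simpa using congrArg η h0)
  obtain ⟨tS, htS, htSev⟩ := exists_cycleInduced_descent_of_partner_of_facts hBI hO hcup hMkI hX hK hM hS hp0 hmk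
    hxx hxpos hu hg1 hg2 hg5 tX ht1 ht2 ht3 ht4 htZ htev
  exact ⟨tS, htS, η.symm x, ev, h20, hxne, htSev, hdeg⟩

/-! ### §2 HC⁴(X) ⟹ HC⁴(S × S), and the two iffs -/

/-- **HC⁴(X) ⟹ HC⁴(S ⊗ S) for a partnered RM fourfold** (`exists_oneCycleK3_of_partner_of_hodgeConjectureFor` +
«K3-CELL-GEN SOCKET» with the descended generator of «PARTNER-RM-TYPE»). No self-adjointness ∕ non-CM hypothesis on
`S` (module docstring). Modulo {Beauville incidence, O'Grady, Voisin cup, Markman isometry-algebraic, Verbitsky–Guan,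
Charles–Markman, Huybrechts marking}. [cite: Markman2024, §1.1 Thm. 1.1] [cite: CharlesMarkman2013, Thm. 1.1 (§1)]
[cite: GeemenSchutt2023, §4.8 and Rem. 4.9] [cite: Zarhin1983HodgeGroupsK3, Thm. 1.5.1] -/
theorem hodgeConjectureFor_partnerSquare_of_hodgeConjectureFor (hBI : Beauville1983_hilbertSquare_markedIncidence)
    (hO : OGrady2008_dualBBFClass_algebraic) (hcup : Voisin2003_cupProduct_algebraicClasses)
    (hMkI : Markman2024_rationalHodgeIsometry_algebraic_marked) (hV : VerbitskyGuan_cohomology_K3HilbertSquareType)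
    (hB : CharlesMarkman2013_lefschetzStandard_K3HilbertType) (hmark : Huybrechts_K3_marking_exists)
    (hX : IsSmoothProjective 4 X) (hK : IsOfK3HilbertSquareType X) (hM : MarkedK3Sq[X, φ, P, z]) {d : ℕ}
    (hR : RMgen[X, φ, z, d]) (hS : IsK3Surface S) (hMS : MarkedK3[S, η, p, x])
    {g : complexBetti S (2 * 1) →ₗ[ℂ] complexBetti X 2} (hg : Partner[X, φ, S, η, g]) (hHC : HodgeConjectureFor 4 X) :
    HodgeConjectureFor 4 (S ⊗ S) := by
  obtain ⟨t, ht, ht_ev⟩ := exists_oneCycleK3_of_partner_of_hodgeConjectureFor hBI hO hcup hMkI hV hB hX hK hM hR hS hMS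
    hg hHC
  obtain ⟨hp0, hmk, hxx, hxpos, hu⟩ := hMS
  obtain ⟨hg1, hg2, hg5⟩ := hg
  obtain ⟨θS, h1, h2, hgen, ev₀, hev₀, -, hdeg₀⟩ :=
    exists_generator_natDegree_of_partner_of_facts hBI hcup hX hM hS hp0 hmk hxx hxpos hu hg1 hg2 hg5 hR
  have h20 : IsOfHodgeType 2 S (2 * 1) 2 0 (η.symm x) := hmk.2.2.2.2.1
  have hxne : η.symm x ≠ 0 := fun h0 => ne_zero_of_star_self_re_pos hxpos (by simpa using congrArg η h0)
  exact OneCycle.hodgeConjectureFor_square_of_generatedBy_of_cycleInduced_natDegree hmark hS θS h1 h2 hgen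
    ⟨η.symm x, ev₀, h20, hxne, hev₀, hdeg₀⟩ t ht ht_ev

/-- **«PARTNERED LOSSLESS IFF», squares: HC⁴(X) ⟺ HC⁴(S ⊗ S)** for a marked `K3^{[2]}`-type `X` with `RMgen[X, φ, z, d]`
and a K3 partner `(S, η, p, x, g)` — (⟹) `hodgeConjectureFor_partnerSquare_of_hodgeConjectureFor`, (⟸) `PartnerTransport`
(`partnerTransport_explicit`). Modulo the nine displayed facts. [cite: Markman2024, §1.1 Thm. 1.1 and Thm. 1.4]
[cite: Beauville1983, §6 (e)–(f), Prop. 6] [cite: CharlesMarkman2013, Thm. 1.1 (§1)] -/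
theorem hodgeConjectureFor_iff_partnerSquare (hBI : Beauville1983_hilbertSquare_markedIncidence)
    (hBea : Beauville1983_hilbertSquare_blowupDiagonal_surjection) (hO : OGrady2008_dualBBFClass_algebraic)
    (hMk : Markman2024_rationalHodgeIsometry_lift_algebraic_marked) (hcup : Voisin2003_cupProduct_algebraicClasses)
    (hMkI : Markman2024_rationalHodgeIsometry_algebraic_marked) (hV : VerbitskyGuan_cohomology_K3HilbertSquareType)
    (hB : CharlesMarkman2013_lefschetzStandard_K3HilbertType) (hmark : Huybrechts_K3_marking_exists)
    (hX : IsSmoothProjective 4 X) (hK : IsOfK3HilbertSquareType X) (hM : MarkedK3Sq[X, φ, P, z]) {d : ℕ}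
    (hR : RMgen[X, φ, z, d]) (hS : IsK3Surface S) (hMS : MarkedK3[S, η, p, x])
    {g : complexBetti S (2 * 1) →ₗ[ℂ] complexBetti X 2} (hg : Partner[X, φ, S, η, g]) :
    HodgeConjectureFor 4 X ↔ HodgeConjectureFor 4 (S ⊗ S) := by
  refine ⟨hodgeConjectureFor_partnerSquare_of_hodgeConjectureFor hBI hO hcup hMkI hV hB hmark hX hK hM hR hS hMS hg,
    fun hsq => ?_⟩
  obtain ⟨_, hmk, hxx, hxpos, hu⟩ := hMS
  obtain ⟨hg1, hg2, hg5⟩ := hg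
  exact partnerTransport_explicit hBI hBea hMk hcup hX hK hM hS hmk hxx hxpos hu hg1 hg2 hg5 hsq

/-- **«PARTNERED LOSSLESS IFF», cycles: HC⁴(X) ⟺ `OneCycleK3[S, hS, d]`** — the Hodge conjecture for a partnered member
of the cell `(ρ, d)` is EXACTLY the existence of ONE cycle-induced transcendental endomorphism of `(2,0)`-eigenvalue
degree `d` on its K3 partner ((⟸) `hodgeConjectureFor_of_partner_of_rmGenerator_of_cycleInduced_natDegree`). Modulo
the displayed facts. [cite: Markman2024, §1.1 Thm. 1.1 and Thm. 1.4] [cite: GeemenSchutt2023, §4.8 and Rem. 4.9]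
[cite: CharlesMarkman2013, Thm. 1.1 (§1)] -/
theorem hodgeConjectureFor_iff_oneCycleK3_of_partner (hBI : Beauville1983_hilbertSquare_markedIncidence)
    (hBea : Beauville1983_hilbertSquare_blowupDiagonal_surjection) (hO : OGrady2008_dualBBFClass_algebraic)
    (hMk : Markman2024_rationalHodgeIsometry_lift_algebraic_marked) (hcup : Voisin2003_cupProduct_algebraicClasses)
    (hMkI : Markman2024_rationalHodgeIsometry_algebraic_marked) (hV : VerbitskyGuan_cohomology_K3HilbertSquareType)
    (hB : CharlesMarkman2013_lefschetzStandard_K3HilbertType) (hmark : Huybrechts_K3_marking_exists)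
    (hX : IsSmoothProjective 4 X) (hK : IsOfK3HilbertSquareType X) (hM : MarkedK3Sq[X, φ, P, z]) {d : ℕ}
    (hR : RMgen[X, φ, z, d]) (hS : IsK3Surface S) (hMS : MarkedK3[S, η, p, x])
    {g : complexBetti S (2 * 1) →ₗ[ℂ] complexBetti X 2} (hg : Partner[X, φ, S, η, g]) :
    HodgeConjectureFor 4 X ↔ OneCycleK3[S, hS, d] := by
  refine ⟨exists_oneCycleK3_of_partner_of_hodgeConjectureFor hBI hO hcup hMkI hV hB hX hK hM hR hS hMS hg, fun h => ?_⟩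
  obtain ⟨t, ht, ht_ev⟩ := h
  exact hodgeConjectureFor_of_partner_of_rmGenerator_of_cycleInduced_natDegree hBI hBea hMk hcup hmark hX hK hM hR hS
    hMS hg t ht ht_ev

/-! ### §3 By name, on every cell -/

/-- **`PartneredHC[ρ, d] ↔ PartneredOneCycleK3[ρ, d]` for EVERY `(ρ, d)`** — HC⁴ for all partnered members of a cell of
crux #5 is EXACTLY «one cycle of eigenvalue degree `d` on every K3 partner»; the partner datum ((g1), (g2), (g5)) is
explicit on both sides. Modulo the nine displayed facts. [cite: Markman2024, §1.1 Thm. 1.1 and Thm. 1.4]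
[cite: GeemenSchutt2023, §4.8 and Rem. 4.9] [cite: CharlesMarkman2013, Thm. 1.1 (§1)] -/
theorem cellHC_iff_oneCycleK3_of_partner (hBI : Beauville1983_hilbertSquare_markedIncidence)
    (hBea : Beauville1983_hilbertSquare_blowupDiagonal_surjection) (hO : OGrady2008_dualBBFClass_algebraic)
    (hMk : Markman2024_rationalHodgeIsometry_lift_algebraic_marked) (hcup : Voisin2003_cupProduct_algebraicClasses)
    (hMkI : Markman2024_rationalHodgeIsometry_algebraic_marked) (hV : VerbitskyGuan_cohomology_K3HilbertSquareType)
    (hB : CharlesMarkman2013_lefschetzStandard_K3HilbertType) (hmark : Huybrechts_K3_marking_exists) (ρ d : ℕ) :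
    PartneredHC[ρ, d] ↔ PartneredOneCycleK3[ρ, d] := by
  refine ⟨fun h X hX hK φ P z hM hsp hρ hR S hS η p x g hMS hg => ?_,
    fun h X hX hK φ P z hM hsp hρ hR S hS η p x g hMS hg => ?_⟩
  · exact (hodgeConjectureFor_iff_oneCycleK3_of_partner hBI hBea hO hMk hcup hMkI hV hB hmark hX hK hM hR hS hMS hg).1
      (h X hX hK φ P z hM hsp hρ hR S hS η p x g hMS hg)
  · exact (hodgeConjectureFor_iff_oneCycleK3_of_partner hBI hBea hO hMk hcup hMkI hV hB hmark hX hK hM hR hS hMS hg).2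
      (h X hX hK φ P z hM hsp hρ hR S hS η p x g hMS hg)

/-! ### Appended (gen 16, rider J2 «HILBERT-SQUARE LOSSLESS», p1 g40 19:04Z): `X = S^{[2]}` is partnered by
Beauville's incidence -/

/-- **Beauville's incidence `[θ]_* : H²(S) → H²(S^{[2]})` is a partner map** ((g1) rational, (g2) type-preserving —
`(0,2)` by conjugation, `[θ]_*` being real (`conjClass_apply_of_isRationalClass₂`) —, (g5) `q((ηa,0),(ηb,0)) = (ηa·ηb)`),
for the marked Hilbert square `(H, φ_H, P_H, (x,0))` of a marked projective K3 surface `(S, η, p, x)` with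
`φ_H([θ]_* a) = (η a, 0)`. [cite: Beauville1983, §6 Prop. 6 and Remarque, §9 Lemme 1] [cite: VoisinHodgeI2002, Cor. 6.12] -/
theorem partner_incidence {H : SchemeOver ℂ} {φH : complexBetti H 2 ≃ₗ[ℂ] (K3HilbertIndex → ℂ)}
    {PH : complexBetti H (2 * 4)} (hS : IsK3Surface S) (hp0 : p ≠ 0)
    (hηint : ∀ c : complexBetti S (2 * 1), IsIntegralClass c ↔ ∃ v : K3Index → ℤ, η c = fun i => (v i : ℂ))
    (hcupS : ∀ a b : complexBetti S (2 * 1),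
      cupProduct (rfl : 2 * 1 + 2 * 1 = 2 * 2) a b = k3Form (η a) (η b) • p)
    (h20 : IsOfHodgeType 2 S (2 * 1) 2 0 (η.symm x))
    (h20span : ∀ τ : complexBetti S (2 * 1), IsOfHodgeType 2 S (2 * 1) 2 0 τ → ∃ t : ℂ, τ = t • η.symm x)
    (hxpos : 0 < (k3Form (star x) x).re) (hH : IsSmoothProjective 4 H) (hMH : MarkedK3Sq[H, φH, PH, Sum.elim x 0])
    {θ : complexBetti (H ⊗ S) (2 * 2)}
    (hi : ∀ a : complexBetti S (2 * 1),
      φH (corrAction complexOrientationFamily hH (IsK3Surface.isSmoothProjective hS)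
        (rfl : 2 * 1 + 2 * 2 = 2 + 2 * 2) θ a) = Sum.elim (η a) 0) :
    Partner[H, φH, S, η,
      corrAction complexOrientationFamily hH (IsK3Surface.isSmoothProjective hS) (rfl : 2 * 1 + 2 * 2 = 2 + 2 * 2) θ] := by
  obtain ⟨-, hintH, -⟩ := id hMH
  have hS2 : IsSmoothProjective 2 S := IsK3Surface.isSmoothProjective hS
  set i : complexBetti S (2 * 1) →ₗ[ℂ] complexBetti H 2 :=
    corrAction complexOrientationFamily hH hS2 (rfl : 2 * 1 + 2 * 2 = 2 + 2 * 2) θ with hidef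
  have hi' : ∀ a, φH (i a) = Sum.elim (η a) 0 := hi
  have h1 : ∀ a, IsRationalClass a → IsRationalClass (i a) := fun a ha =>
    isRationalClass_incidence hS hH hηint hintH hi' ha
  have h20H : ∀ c, IsOfHodgeType 2 S (2 * 1) 2 0 c → IsOfHodgeType 4 H 2 2 0 (i c) := fun c hc =>
    incidence_twoZero hMH h20span hi' hc
  have h11H : ∀ c, IsOfHodgeType 2 S (2 * 1) 1 1 c → IsOfHodgeType 4 H 2 1 1 (i c) := fun c hc =>
    incidence_oneOne hS hp0 hηint hcupS h20 hxpos hMH hi' hc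
  have hconj : ∀ c, i (conjClass (ComplexPoints S) (2 * 1) c) = conjClass (ComplexPoints H) (2 * 1) (i c) :=
    fun c => (QuotientSimilitude.conjClass_apply_of_isRationalClass₂ η hηint i h1 c).symm
  refine ⟨h1, fun a b c hc => ?_, fun a b _ _ => ?_⟩
  · by_cases hab : a + b = 2 * 1
    · have ha2 : a ≤ 2 := by omega
      interval_cases a
      · have hb : b = 2 := by omega
        subst hb
        have h := (h20H _ (hc.conjClass hS2)).conjClass hH
        rw [← hconj, conjClass_conjClass] at h
        exact h
      · have hb : b = 1 := by omega
        subst hb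
        exact h11H c hc
      · have hb : b = 0 := by omega
        subst hb
        exact h20H c hc
    · have hc0 : c = 0 := by
        obtain ⟨A, hA⟩ := hc
        rw [(A.hodgePQ_eq_bot_iff (2 * 1) a b).2
            (Literature.NumberTheory.Transcendental.hodgePQ_eq_bot_of_ne (M := A.carrier) hab),
          Submodule.mem_bot] at hA
        exact A.pullback_injective (2 * 1) (by rw [hA, map_zero])
      rw [hc0, map_zero]
      exact isOfHodgeType_zero_of_isSmoothProjective nonempty_hodgeModel_holds hH 2 a b
  · rw [hi', hi', k3HilbertForm_sumElim_zero_left]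
    rfl

/-- **«HILBERT-SQUARE LOSSLESS»: HC⁴(S^{[2]}) ⟺ `OneCycleK3[S, hS, d]`** for Beauville's marked Hilbert square
`(H, φ_H, P_H, (x,0))` (of `K3^{[2]}` type, with algebraic incidence) of a marked projective K3 surface carrying the RM
datum `RMgen[H, φ_H, (x,0), d]` — the `X = S^{[2]}` instance of `hodgeConjectureFor_iff_oneCycleK3_of_partner`, partnered by
`partner_incidence`. Modulo the nine displayed facts. [cite: Beauville1983, §6 Prop. 6] [cite: Markman2024, §1.1 Thm. 1.1 and Thm. 1.4]
[cite: GeemenSchutt2023, §4.8 and Rem. 4.9] -/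
theorem hodgeConjectureFor_hilbertSquare_iff_oneCycleK3 (hBI : Beauville1983_hilbertSquare_markedIncidence)
    (hBea : Beauville1983_hilbertSquare_blowupDiagonal_surjection) (hO : OGrady2008_dualBBFClass_algebraic)
    (hMk : Markman2024_rationalHodgeIsometry_lift_algebraic_marked) (hcup : Voisin2003_cupProduct_algebraicClasses)
    (hMkI : Markman2024_rationalHodgeIsometry_algebraic_marked) (hV : VerbitskyGuan_cohomology_K3HilbertSquareType)
    (hB : CharlesMarkman2013_lefschetzStandard_K3HilbertType) (hmark : Huybrechts_K3_marking_exists)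
    {H : SchemeOver ℂ} {φH : complexBetti H 2 ≃ₗ[ℂ] (K3HilbertIndex → ℂ)} {PH : complexBetti H (2 * 4)}
    (hH : IsSmoothProjective 4 H) (hKH : IsOfK3HilbertSquareType H) (hMH : MarkedK3Sq[H, φH, PH, Sum.elim x 0])
    (hS : IsK3Surface S) (hMS : MarkedK3[S, η, p, x]) {θ : complexBetti (H ⊗ S) (2 * 2)}
    (hi : ∀ a : complexBetti S (2 * 1),
      φH (corrAction complexOrientationFamily hH (IsK3Surface.isSmoothProjective hS)
        (rfl : 2 * 1 + 2 * 2 = 2 + 2 * 2) θ a) = Sum.elim (η a) 0)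
    {d : ℕ} (hR : RMgen[H, φH, Sum.elim x 0, d]) :
    HodgeConjectureFor 4 H ↔ OneCycleK3[S, hS, d] := by
  obtain ⟨hp0, ⟨-, -, hηint, hcupS, h20, h20span⟩, -, hxpos, -⟩ := id hMS
  exact hodgeConjectureFor_iff_oneCycleK3_of_partner hBI hBea hO hMk hcup hMkI hV hB hmark hH hKH hMH hR hS hMS
    (partner_incidence hS hp0 hηint hcupS h20 h20span hxpos hH hMH hi)


end Summit.HodgeConjecture.HodgeConjecture.Theorems.MarkmanPartnerTransport.PartnerLattice

end
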